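import Summits.Ventures.YMGap.RobustBall.ErgodicAverages
import Summits.Ventures.YMGap.RobustBall.SpecificHeatFloor
import Summits.Ventures.YMGap.RobustBall.WilsonOneStateSymmetry
import Summits.Ventures.YMGap.RobustBall.ThermodynamicVariance
import HarnessLib

/-!
# Venture YMGap, track ROBUST-BALL — «C-SING», SHARP FORM: THE COUPLING CONSTANT IS AN ALMOST-SURE OBSERVABLE. One measurable function of the
# infinite-volume configuration recovers the coupling EXACTLY, simultaneously for every coupling of the window (`SU(2)` on `ℤ⁴`, tree coupling
# `b ∈ [0, 9/50)`; every `SU(N)` on `ℤ^d` on the 't Hooft single-link window)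

HONEST FRAMING. WHAT THIS IS: a venture file (cell `pub-ymgap`, track Y2 ROBUST-BALL / DS, seat ds-3, theorems only, 0 compute, 0 defs): the sharp form
of the mutual singularity of the strong-coupling states (`StatesMutuallySingular`, `StatesMutuallySingularZero`). There is ONE measurable map
`T : (ℤ⁴-configurations) → ℝ` — "read off the coupling" — such that for EVERY `b ∈ [0, 9/50)` and every DLR state `μ ∈ 𝒢(b)` (each is unique),
`T = b` `μ`-almost surely: the statistical family `{μ_b}` is PERFECTLY IDENTIFIABLE (an "orthogonal" family: the level sets `T⁻¹{b}` are pairwise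
disjoint measurable supports). `T(U) = g(limsup_n #B_n⁻¹ Σ_{x∈B_n} Re tr U_{θ_x p})` with `g` the generalised inverse of the mean-plaquette curve
`b ↦ u(b)`: the ergodic theorem for the plaquette under THE state (`ErgodicAverages.su2_wilson_ae_tendsto_boxAverage`) and the STRICT monotonicity
of `u` on the window (`PressureRegularity.su2_plaquette_monotoneOn` + `EnergyVariance.su2_plaquette_increment_ge`).

* `csSup_sublevel_eq`, `monotone_csSup_sublevel` — the generalised inverse of a strictly increasing curve (generic);
* ★★★ `su2_coupling_ae_identifiable` — `∃ T measurable, ∀ b ∈ [0, 9/50), ∀ μ ∈ 𝒢(b), T = b μ-a.s.`;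
* ★★ `su2_states_disjoint_supports` — pairwise disjoint measurable supports `E_b` with `μ(E_bᶜ) = 0` for every `μ ∈ 𝒢(b)`, all `b ∈ [0, 9/50)` at once;
* ★★★ `suN_coupling_ae_identifiable_dim` — every `N ≥ 2`, `d ≥ 2`: 't Hooft coupling `β ∈ [0, min(1/(12(d−1)), 1/(8d)))` is recovered a.s. from
  the configuration under every DLR state at tree coupling `Nβ` — HYPOTHESIS-FREE; ★★ `suN_states_disjoint_supports_dim` — its disjoint-supports form.

WHAT THIS IS NOT: lattice strong coupling; nothing about the continuum limit or Clay. Everything here is proved. [folklore]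
-/

noncomputable section

open MeasureTheory ProbabilityTheory Filter Topology Real Finset Set
open scoped NNReal ENNReal
open Literature.Probability.LatticeModels hiding configShift configShift_apply
open Literature.MathematicalPhysics.QuantumLattice
open Literature.MathematicalPhysics.QuantumFieldTheory (zdPlaquetteObs)

namespace Summit.Ventures.YMGap.RobustBall

namespace BoundaryFreeEnergy

/-! ### Generic: the generalised inverse of a strictly increasing curve -/

/-- If `b ∈ S` and `u b < u t` for every `t ∈ S` beyond `b`, then `sup {t ∈ S : u t ≤ u b} = b`. [folklore] -/
theorem csSup_sublevel_eq {u : ℝ → ℝ} {S : Set ℝ} {b : ℝ} (hb : b ∈ S) (hstrict : ∀ t ∈ S, b < t → u b < u t) :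
    sSup {t ∈ S | u t ≤ u b} = b :=
  IsGreatest.csSup_eq ⟨⟨hb, le_rfl⟩, fun t ht => not_lt.1 fun hbt => (not_le.2 (hstrict t ht.1 hbt)) ht.2⟩

/-- The generalised inverse `y ↦ sup {t ∈ S : u t ≤ y}` of a curve over a bounded set of nonnegative parameters is monotone (hence
measurable). [folklore] -/
theorem monotone_csSup_sublevel {u : ℝ → ℝ} {S : Set ℝ} (hS : BddAbove S) (hS0 : ∀ t ∈ S, 0 ≤ t) :
    Monotone fun y : ℝ => sSup {t ∈ S | u t ≤ y} := by
  intro y y' hyy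
  show sSup {t ∈ S | u t ≤ y} ≤ sSup {t ∈ S | u t ≤ y'}
  have hsub : {t ∈ S | u t ≤ y} ⊆ {t ∈ S | u t ≤ y'} := fun t ht => ⟨ht.1, ht.2.trans hyy⟩
  have hbdd : BddAbove {t ∈ S | u t ≤ y'} := hS.mono fun t ht => ht.1
  by_cases hne : ({t ∈ S | u t ≤ y} : Set ℝ).Nonempty
  · exact csSup_le_csSup hbdd hne hsub
  · rw [Set.not_nonempty_iff_eq_empty] at hne
    rw [hne, Real.sSup_empty]
    by_cases hne' : ({t ∈ S | u t ≤ y'} : Set ℝ).Nonempty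
    · obtain ⟨t, ht⟩ := hne'
      exact (hS0 t ht.1).trans (le_csSup hbdd ht)
    · rw [Set.not_nonempty_iff_eq_empty] at hne'
      rw [hne', Real.sSup_empty]

/-! ### `SU(2)`, `d = 4`, tree couplings `b ∈ [0, 9/50)` -/

section SU2

/-- ★★★ **THE COUPLING IS AN ALMOST-SURE OBSERVABLE** (`SU(2)`, `d = 4`): there is ONE measurable `T : (configurations) → ℝ` such that for EVERY
tree coupling `b ∈ [0, 9/50)` and EVERY DLR state `μ ∈ 𝒢(b)`, `T(U) = b` for `μ`-almost every `U` — the family of strong-coupling Yang–Mills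
states is perfectly identifiable. [folklore] -/
theorem su2_coupling_ae_identifiable :
    ∃ T : LGConfig 4 (SUN 2) → ℝ, Measurable T ∧
      ∀ b : ℝ, 0 ≤ b → b < 9 / 50 → ∀ μ : Measure (LGConfig 4 (SUN 2)), μ ∈ ymGibbsMeasures (d := 4) (fundamentalRep (Fin 2)) b →
        ∀ᵐ U ∂μ, T U = b := by
  classical
  have hρc : Continuous (fundamentalRep (Fin 2)) := continuous_fundamentalRep (Fin 2)
  set F : LGConfig 4 (SUN 2) → ℝ := plaquetteObs (fundamentalRep (Fin 2)) 0 0 1 with hF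
  have hloc : IsLocalObservable F := ⟨_, isCylinder_plaquetteObs_zero (fundamentalRep (Fin 2)) 0 1⟩
  have hFm : Measurable F := measurable_plaquetteObs _ hρc 0 0 1
  have hFb : ∃ C, ∀ U, |F U| ≤ C :=
    ⟨2, fun U => by simpa using abs_plaquetteObs_le_holds (fundamentalRep (Fin 2)) fundamentalRep_mem_unitaryGroup 0 0 1 U⟩
  have hFg : IsZdGaugeInvariant F := isZdGaugeInvariant_plaquetteObs (fundamentalRep (Fin 2)) 0 0 1
  -- a DLR selection and the mean-plaquette curve along it: monotone on `[0, 9/50]`, strictly increasing on `[0, 9/50)`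
  obtain ⟨ν, hν⟩ := CouplingResponse.exists_dlrSelection_dim (d := 4) (N := 2)
  set u : ℝ → ℝ := fun t => ∫ U, F U ∂(ν t) with hu
  have hmono : MonotoneOn u (Icc (0 : ℝ) (9 / 50)) :=
    PressureRegularity.su2_plaquette_monotoneOn (μ := ν) (fun t _ => hν t) (((0 : Site 4), ⟨((0 : Fin 4), (1 : Fin 4)), by decide⟩) : ZdPlaquette 4)
  have hstrict : ∀ s ∈ Ico (0 : ℝ) (9 / 50), ∀ t ∈ Ico (0 : ℝ) (9 / 50), s < t → u s < u t := by
    intro s hs t ht hst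
    set m : ℝ := (s + t) / 2 with hm
    have hm0 : 0 < m := by rw [hm]; linarith [hs.1]
    have hmt : m < t := by rw [hm]; linarith
    have hsm : s ≤ m := by rw [hm]; linarith
    have h1 : u s ≤ u m := hmono ⟨hs.1, by linarith [ht.2]⟩ ⟨hm0.le, by linarith [ht.2]⟩ hsm
    have hinc := EnergyVariance.su2_plaquette_increment_ge hm0 hmt ht.2 (hν m) (hν t)
    have hpos : 0 < Real.exp (-(48 * t)) / 24 * (t - m) := mul_pos (by positivity) (by linarith)
    have e₁ : u m = 2 * ∫ U, zdPlaquetteObs (fundamentalRep (Fin 2)) 0 0 1 U ∂(ν m) := by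
      simpa using PressureRegularity.integral_plaquetteObs_eq_mul (((0 : Site 4), ⟨((0 : Fin 4), (1 : Fin 4)), by decide⟩) : ZdPlaquette 4) (ν m)
    have e₂ : u t = 2 * ∫ U, zdPlaquetteObs (fundamentalRep (Fin 2)) 0 0 1 U ∂(ν t) := by
      simpa using PressureRegularity.integral_plaquetteObs_eq_mul (((0 : Site 4), ⟨((0 : Fin 4), (1 : Fin 4)), by decide⟩) : ZdPlaquette 4) (ν t)
    rw [e₁] at h1
    rw [e₂]
    linarith
  -- the estimator: generalised inverse of `u` applied to the limsup of the cube averages of the plaquette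
  set A : ℕ → LGConfig 4 (SUN 2) → ℝ := fun n U => (∑ x ∈ siteBox 4 n, F (configShift x U)) / (siteBox 4 n).card with hA
  set g : ℝ → ℝ := fun y => sSup {t ∈ Ico (0 : ℝ) (9 / 50) | u t ≤ y} with hg
  have hAm : ∀ n, Measurable (A n) := fun n =>
    (Finset.measurable_sum _ fun x _ => hFm.comp (configShift x).measurable).div_const _
  have hgm : Measurable g :=
    (monotone_csSup_sublevel (u := u) (S := Ico (0 : ℝ) (9 / 50)) ⟨9 / 50, fun t ht => ht.2.le⟩ fun t ht => ht.1).measurable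
  refine ⟨fun U => g (limsup (fun n => A n U) atTop), hgm.comp (Measurable.limsup hAm), fun b hb0 hb μ hμ => ?_⟩
  -- under `μ ∈ 𝒢(b)` the cube averages converge a.s. to `∫ F dμ = u b`
  obtain ⟨μ', h1, hμ'⟩ := ErgodicAverages.su2_wilson_ae_tendsto_boxAverage (b := b) (abs_le.2 ⟨by linarith, by linarith⟩)
  have hμμ : μ = μ' := by rw [h1] at hμ; exact Set.mem_singleton_iff.1 hμ
  have hνμ : ν b = μ' := by
    have h := hν b
    rw [h1] at h
    exact Set.mem_singleton_iff.1 h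
  have hae := (hμ' F hloc hFm hFb hFg).1
  rw [hμμ]
  filter_upwards [hae] with U hU
  have hlim : limsup (fun n => A n U) atTop = u b := by
    have h := hU.limsup_eq
    rw [← hνμ] at h
    exact h
  show g (limsup (fun n => A n U) atTop) = b
  rw [hlim]
  exact csSup_sublevel_eq (u := u) (S := Ico (0 : ℝ) (9 / 50)) ⟨hb0, hb⟩ fun t ht hbt => hstrict b ⟨hb0, hb⟩ t ht hbt

/-- ★★ **PAIRWISE DISJOINT SUPPORTS, ALL COUPLINGS AT ONCE** (`SU(2)`, `d = 4`): there are pairwise disjoint measurable sets `E_b` with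
`μ(E_bᶜ) = 0` for every `b ∈ [0, 9/50)` and every DLR state `μ ∈ 𝒢(b)` — an orthogonal family of states. [folklore] -/
theorem su2_states_disjoint_supports :
    ∃ E : ℝ → Set (LGConfig 4 (SUN 2)), (∀ b, MeasurableSet (E b)) ∧ (Pairwise fun b b' => Disjoint (E b) (E b')) ∧
      ∀ b : ℝ, 0 ≤ b → b < 9 / 50 → ∀ μ : Measure (LGConfig 4 (SUN 2)), μ ∈ ymGibbsMeasures (d := 4) (fundamentalRep (Fin 2)) b →
        μ (E b)ᶜ = 0 := by
  obtain ⟨T, hT, h⟩ := su2_coupling_ae_identifiable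
  refine ⟨fun b => T ⁻¹' {b}, fun b => hT (measurableSet_singleton b), fun b b' hne => ?_, fun b hb0 hb μ hμ => ?_⟩
  · exact Set.disjoint_iff.2 fun U hU => hne (hU.1.symm.trans hU.2)
  · have h' := h b hb0 hb μ hμ
    rw [ae_iff] at h'
    simpa [Set.preimage, Set.compl_def] using h'

end SU2

/-! ### Every `SU(N)`, every `d ≥ 2` -/

section SUN

variable {d N : ℕ}

/-- ★★★ **THE 'T HOOFT COUPLING IS AN ALMOST-SURE OBSERVABLE, EVERY `N ≥ 2`, EVERY `d ≥ 2`**: there is ONE measurable `T` such that for every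
`β ∈ [0, min(1/(12(d−1)), 1/(8d)))` and every DLR state `μ` at tree coupling `Nβ`, `T(U) = β` for `μ`-almost every `U` — HYPOTHESIS-FREE. [folklore] -/
theorem suN_coupling_ae_identifiable_dim [NeZero d] (hd : 2 ≤ d) (hN : 2 ≤ N) :
    ∃ T : LGConfig d (SUN N) → ℝ, Measurable T ∧
      ∀ β : ℝ, 0 ≤ β → β < 1 / (12 * ((d : ℝ) - 1)) → β < 1 / (8 * (d : ℝ)) →
        ∀ μ : Measure (LGConfig d (SUN N)), μ ∈ ymGibbsMeasures (d := d) (fundamentalRep (Fin N)) (N * β) → ∀ᵐ U ∂μ, T U = β := by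
  classical
  haveI : SecondCountableTopology (Matrix.specialUnitaryGroup (Fin N) ℂ) :=
    haveI : SecondCountableTopology (Matrix (Fin N) (Fin N) ℂ) := inferInstanceAs (SecondCountableTopology (Fin N → Fin N → ℂ))
    Topology.IsEmbedding.subtypeVal.secondCountableTopology
  have hρc : Continuous (fundamentalRep (Fin N)) := continuous_fundamentalRep (Fin N)
  have hN0 : (0 : ℝ) < N := by exact_mod_cast (show 0 < N by omega)
  set i0 : Fin d := ⟨0, by omega⟩ with hi0
  set j1 : Fin d := ⟨1, by omega⟩ with hj1
  have hij : i0 < j1 := by simp [hi0, hj1, Fin.lt_def]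
  set F : LGConfig d (SUN N) → ℝ := plaquetteObs (fundamentalRep (Fin N)) 0 i0 j1 with hF
  have hloc : IsLocalObservable F := ⟨_, isCylinder_plaquetteObs_zero (fundamentalRep (Fin N)) i0 j1⟩
  have hFm : Measurable F := measurable_plaquetteObs _ hρc 0 i0 j1
  have hFb : ∀ U, |F U| ≤ N := fun U => abs_plaquetteObs_le_holds (fundamentalRep (Fin N)) fundamentalRep_mem_unitaryGroup 0 i0 j1 U
  -- almost-sure self-averaging under THE state at every 't Hooft coupling of the sharp window
  have hae : ∀ {c : ℝ} {ν : Measure (LGConfig d (SUN N))}, |c| < HessianSharp.sharpThresholdSU d →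
      ν ∈ ymGibbsMeasures (d := d) (fundamentalRep (Fin N)) (N * c) → IsProbabilityMeasure ν →
      ∀ᵐ U ∂ν, Tendsto (fun n : ℕ => (∑ x ∈ siteBox d n, F (configShift x U)) / (siteBox d n).card) atTop (𝓝 (∫ U', F U' ∂ν)) := by
    intro c ν hc hν _
    obtain ⟨ν', h1, -, hinv, -⟩ := suN_wilson_oneState_symmetric_sharp hd hN hc
    have hνν : ν = ν' := by rw [h1] at hν; exact Set.mem_singleton_iff.1 hν
    rw [← hνν] at hinv
    obtain ⟨cc, hcc, hcl⟩ := (SharpUniquenessJoin.massGapAt_sharp_free hd hN hc).2 ν hν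
    obtain ⟨C₀, hC₀⟩ := MassGapMassive.covariance_decay_of_lipschitzClustering (by omega) (by omega) (N * c) hν hcc hcl F F hloc hloc hFm hFm
      ⟨N, hFb⟩ ⟨N, hFb⟩
    exact ErgodicAverages.ae_tendsto_boxAverage hd hinv hFm hFb (ThermodynamicVariance.summable_abs_of_exp_decay (by omega) hcc hC₀)
  -- a DLR selection (tree coupling) and the mean-plaquette curve along it
  obtain ⟨ν, hν⟩ := CouplingResponse.exists_dlrSelection_dim (d := d) (N := N)
  set u : ℝ → ℝ := fun t => ∫ U, zdPlaquetteObs (fundamentalRep (Fin N)) 0 i0 j1 U ∂(ν t) with hu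
  have hd1 : (0 : ℝ) < 12 * ((d : ℝ) - 1) := by
    have : (2 : ℝ) ≤ d := by exact_mod_cast hd
    linarith
  have hmono : MonotoneOn u (Icc (0 : ℝ) ((N : ℝ) / (12 * ((d : ℝ) - 1)))) :=
    PressureRegularity.plaquette_monotoneOn_dim_thooft hd hN (μ := ν) (fun t _ => hν t) (((0 : Site d), ⟨(i0, j1), hij⟩) : ZdPlaquette d)
  -- the 't Hooft parameter set and the curve `w β = N · u(Nβ)` (the limit of the cube averages of `F`)
  set S : Set ℝ := {β | 0 ≤ β ∧ β < 1 / (12 * ((d : ℝ) - 1)) ∧ β < 1 / (8 * (d : ℝ))} with hS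
  set w : ℝ → ℝ := fun β => N * u (N * β) with hw
  have htree : ∀ β ∈ S, (N : ℝ) * β < (N : ℝ) / (12 * ((d : ℝ) - 1)) := by
    intro β hβ
    rw [lt_div_iff₀ hd1]
    have := (lt_div_iff₀ hd1).1 hβ.2.1
    nlinarith
  have hstrict : ∀ s ∈ S, ∀ t ∈ S, s < t → w s < w t := by
    intro s hs t ht hst
    have ht0 : 0 < t := lt_of_le_of_lt hs.1 hst
    set m : ℝ := N * ((s + t) / 2) with hm
    have hm0 : 0 < m := by rw [hm]; exact mul_pos hN0 (by linarith [hs.1])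
    have hmt : m < N * t := by rw [hm]; exact mul_lt_mul_of_pos_left (by linarith) hN0
    have hsm : (N : ℝ) * s ≤ m := by rw [hm]; exact mul_le_mul_of_nonneg_left (by linarith) hN0.le
    have htw := htree t ht
    have h1 : u (N * s) ≤ u m :=
      hmono ⟨by have := hs.1; positivity, by linarith⟩ ⟨hm0.le, by linarith⟩ hsm
    have hinc := EnergyVariance.plaquette_increment_ge_dim_thooft hd hN (b₁ := m) (b₂ := N * t) hm0 hmt htw (hν m) (hν (N * t))
    have hV : 0 < Literature.MathematicalPhysics.QuantumFieldTheory.PlaquetteLowerBound.charVariance (fundamentalRep (Fin N)) :=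
      Literature.MathematicalPhysics.QuantumFieldTheory.PlaquetteLowerBound.charVariance_pos _ hρc (by omega)
    have hpos : 0 < (1 / 2 : ℝ) * Real.exp (-(8 * (d - 1 : ℕ) * N * (N * t))) *
        Literature.MathematicalPhysics.QuantumFieldTheory.PlaquetteLowerBound.charVariance (fundamentalRep (Fin N)) * (N * t - m) := by
      have : 0 < (N : ℝ) * t - m := by linarith
      positivity
    have hplpos : (0 : ℝ) < Fintype.card {q : Fin d × Fin d // q.1 < q.2} := by
      have : Nonempty {q : Fin d × Fin d // q.1 < q.2} := ⟨⟨(i0, j1), hij⟩⟩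
      exact_mod_cast Fintype.card_pos
    have hlt : u m < u (N * t) := by
      by_contra hge
      have hge' := not_lt.1 hge
      have : (Fintype.card {q : Fin d × Fin d // q.1 < q.2} : ℝ) * N * (u (N * t) - u m) ≤ 0 :=
        mul_nonpos_of_nonneg_of_nonpos (by positivity) (by linarith)
      linarith
    show (N : ℝ) * u (N * s) < N * u (N * t)
    exact mul_lt_mul_of_pos_left (lt_of_le_of_lt h1 hlt) hN0
  -- the estimator
  set A : ℕ → LGConfig d (SUN N) → ℝ := fun n U => (∑ x ∈ siteBox d n, F (configShift x U)) / (siteBox d n).card with hA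
  set g : ℝ → ℝ := fun y => sSup {t ∈ S | w t ≤ y} with hg
  have hAm : ∀ n, Measurable (A n) := fun n =>
    (Finset.measurable_sum _ fun x _ => hFm.comp (configShift x).measurable).div_const _
  have hgm : Measurable g :=
    (monotone_csSup_sublevel (u := w) (S := S) ⟨1 / (8 * (d : ℝ)), fun t ht => ht.2.2.le⟩ fun t ht => ht.1).measurable
  refine ⟨fun U => g (limsup (fun n => A n U) atTop), hgm.comp (Measurable.limsup hAm), fun β hβ0 hβ hβ' μ hμ => ?_⟩
  have hβS : β ∈ S := ⟨hβ0, hβ, hβ'⟩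
  have hβs : |β| < HessianSharp.sharpThresholdSU d := by rw [abs_of_nonneg hβ0]; exact hβ'
  have hG : IsGibbsMeasure (ymSpecification (d := d) (fundamentalRep (Fin N)) (N * β)) μ := hμ
  haveI := hG.isProbabilityMeasure
  have ha := hae hβs hμ inferInstance
  -- `ν (Nβ) = μ` by uniqueness, so the a.s. limit is `w β`
  obtain ⟨ν', h1, -, -, -⟩ := suN_wilson_oneState_symmetric_sharp hd hN hβs
  have hμμ : μ = ν' := by rw [h1] at hμ; exact Set.mem_singleton_iff.1 hμ
  have hνμ : ν (N * β) = μ := by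
    have h := hν (N * β)
    rw [h1] at h
    rw [hμμ]
    exact Set.mem_singleton_iff.1 h
  have e : ∫ U, F U ∂μ = w β := by
    show ∫ U, F U ∂μ = N * ∫ U, zdPlaquetteObs (fundamentalRep (Fin N)) 0 i0 j1 U ∂(ν (N * β))
    rw [hνμ]
    exact PressureRegularity.integral_plaquetteObs_eq_mul (((0 : Site d), ⟨(i0, j1), hij⟩) : ZdPlaquette d) μ
  filter_upwards [ha] with U hU
  have hlim : limsup (fun n => A n U) atTop = w β := by
    have h := hU.limsup_eq
    rw [e] at h
    exact h
  show g (limsup (fun n => A n U) atTop) = β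
  rw [hlim]
  exact csSup_sublevel_eq (u := w) (S := S) hβS fun t ht hbt => hstrict β hβS t ht hbt

/-- ★★ **PAIRWISE DISJOINT SUPPORTS, ALL 'T HOOFT COUPLINGS AT ONCE, EVERY `N ≥ 2`, `d ≥ 2`**: pairwise disjoint measurable sets `E_β` with
`μ(E_βᶜ) = 0` for every `β ∈ [0, min(1/(12(d−1)), 1/(8d)))` and every DLR state `μ` at tree coupling `Nβ`. [folklore] -/
theorem suN_states_disjoint_supports_dim [NeZero d] (hd : 2 ≤ d) (hN : 2 ≤ N) :
    ∃ E : ℝ → Set (LGConfig d (SUN N)), (∀ β, MeasurableSet (E β)) ∧ (Pairwise fun β β' => Disjoint (E β) (E β')) ∧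
      ∀ β : ℝ, 0 ≤ β → β < 1 / (12 * ((d : ℝ) - 1)) → β < 1 / (8 * (d : ℝ)) →
        ∀ μ : Measure (LGConfig d (SUN N)), μ ∈ ymGibbsMeasures (d := d) (fundamentalRep (Fin N)) (N * β) → μ (E β)ᶜ = 0 := by
  obtain ⟨T, hT, h⟩ := suN_coupling_ae_identifiable_dim (d := d) (N := N) hd hN
  refine ⟨fun β => T ⁻¹' {β}, fun β => hT (measurableSet_singleton β), fun β β' hne => ?_, fun β hβ0 hβ hβ' μ hμ => ?_⟩
  · exact Set.disjoint_iff.2 fun U hU => hne (hU.1.symm.trans hU.2)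
  · have h' := h β hβ0 hβ hβ' μ hμ
    rw [ae_iff] at h'
    simpa [Set.preimage, Set.compl_def] using h'

end SUN

end BoundaryFreeEnergy

end Summit.Ventures.YMGap.RobustBall

end
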